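import Summits.HubbardSuperconductivity.HubbardLadder.HeisenbergPlusAntipodalRow

/-!
# Plus-antipodal laminar Lieb–Mattis row — part C: torus ground state (pseudo F29; STAGED, not filed; chain A → B → C)

HONEST FRAMING: ladder R1–R4 with certified numbers; no claim on H/H₀.
Window form in the 2D Heisenberg AF torus ground state (`heisRedCorr2 L 1 a b = c_L(a,b)`), every `L ≥ 3`:
`heis_plusRow_window` : `0 ≤ 1/4 + 2c(0,1) - c(1,1) + c(0,2)`; `heis_ceilingRow_window` :
`0 ≤ 5/12 + 4c(0,1) + c(0,2)`; and for even `L = 2k ≥ 4` the conversion of an energy ceiling into a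
`c(0,2)` floor, `heisRedCorr2_0_2_ge_of_groundEnergy_le` : `E₀ ≤ qL² → -5/12 - 2q/3 ≤ c_L(0,2)`, with the
instance `heisRedCorr2_0_2_ge_of_node8x8` (`q = -705592546443/2⁴⁰`, the value asserted for `8 ∣ L ≥ 16` by the
mbboot E2 CLAIM NODE `heisTL_mps_upper_8x8_D48` — a program-verified certificate claim, NOT a kernel theorem;
any use is CONDITIONAL on it) : `0.011155 ≤ c_L(0,2)`.
Intended tree path: `Summits/HubbardSuperconductivity/HubbardLadder/HeisenbergPlusAntipodalRowTorus.lean`.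
-/


noncomputable section

open Matrix Complex Finset
open scoped ComplexOrder Matrix.Norms.L2Operator MatrixOrder

namespace Summit.HubbardSuperconductivity.HubbardLadder.PlusAntipodal

open Literature.MathematicalPhysics.QuantumLattice SpinOperators

variable {Λ : Type*} [Fintype Λ] [DecidableEq Λ]

/-! ### Transfer to the torus ground state (window form, `heisRedCorr2`) -/

section Torus

open Literature.Probability.LatticeModels

/-- Window point `(a, b) ↦` torus site `(a mod L, b mod L)`. -/
def wpt (L : ℕ) (p : ℕ × ℕ) : TorusSite 2 L := ![((p.1 : ℕ) : ZMod L), ((p.2 : ℕ) : ZMod L)]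

/-- Window points with coordinates `< L` are distinct torus sites. -/
theorem wpt_inj (L : ℕ) [NeZero L] {p q : ℕ × ℕ} (hp : p.1 < L ∧ p.2 < L) (hq : q.1 < L ∧ q.2 < L)
    (h : wpt L p = wpt L q) : p = q := by
  have h1 := congrFun h 0
  have h2 := congrFun h 1
  simp only [wpt, Matrix.cons_val_zero, Matrix.cons_val_one, Matrix.cons_val_fin_one] at h1 h2
  rw [ZMod.natCast_eq_natCast_iff'] at h1 h2
  rw [Nat.mod_eq_of_lt hp.1, Nat.mod_eq_of_lt hq.1] at h1
  rw [Nat.mod_eq_of_lt hp.2, Nat.mod_eq_of_lt hq.2] at h2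
  exact Prod.ext h1 h2

/-- `re ω(𝐒_p·𝐒_q) = 3 c(a, b)` for distinct window points with `|Δ| = (a, b)`. -/
theorem re_gsf_wpt (L : ℕ) [NeZero L] {p q : ℕ × ℕ} (hne : wpt L p ≠ wpt L q) (a b : ℕ)
    (ha : Int.natAbs ((p.1 : ℤ) - q.1) = a) (hb : Int.natAbs ((p.2 : ℤ) - q.2) = b) :
    ((heisenbergTorus 2 L 1 1).groundStateFunctional (spinDot 1 (wpt L p) (wpt L q))).re =
      3 * heisRedCorr2 L 1 a b := by
  rw [← ha, ← hb]
  exact re_groundStateFunctional_spinDot_window L hne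

/-- **Plus-antipodal row in the torus ground state**: `0 ≤ ¼ + 2c(0,1) - c(1,1) + c(0,2)` for every
`L ≥ 3` (window centre `(1,1)`, arms `(1,2), (1,0), (2,1), (0,1)`). -/
theorem heis_plusRow_window (L : ℕ) [NeZero L] (hL : 3 ≤ L) :
    0 ≤ 1 / 4 + 2 * heisRedCorr2 L 1 0 1 - heisRedCorr2 L 1 1 1 + heisRedCorr2 L 1 0 2 := by
  have dist : ∀ p q : ℕ × ℕ, p.1 < L ∧ p.2 < L → q.1 < L ∧ q.2 < L → p ≠ q → wpt L p ≠ wpt L q :=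
    fun p q hp hq hpq h => hpq (wpt_inj L hp hq h)
  have b0 : 0 < L := by omega
  have b1 : 1 < L := by omega
  have b2 : 2 < L := by omega
  have hcn := dist (1, 1) (1, 2) ⟨b1, b1⟩ ⟨b1, b2⟩ (by decide)
  have hcs := dist (1, 1) (1, 0) ⟨b1, b1⟩ ⟨b1, b0⟩ (by decide)
  have hce := dist (1, 1) (2, 1) ⟨b1, b1⟩ ⟨b2, b1⟩ (by decide)
  have hcw := dist (1, 1) (0, 1) ⟨b1, b1⟩ ⟨b0, b1⟩ (by decide)
  have hns := dist (1, 2) (1, 0) ⟨b1, b2⟩ ⟨b1, b0⟩ (by decide)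
  have hne := dist (1, 2) (2, 1) ⟨b1, b2⟩ ⟨b2, b1⟩ (by decide)
  have hnw := dist (1, 2) (0, 1) ⟨b1, b2⟩ ⟨b0, b1⟩ (by decide)
  have hse := dist (1, 0) (2, 1) ⟨b1, b0⟩ ⟨b2, b1⟩ (by decide)
  have hsw := dist (1, 0) (0, 1) ⟨b1, b0⟩ ⟨b0, b1⟩ (by decide)
  have hew := dist (2, 1) (0, 1) ⟨b2, b1⟩ ⟨b0, b1⟩ (by decide)
  haveI : Nonempty (TorusSite 2 L) := ⟨wpt L (1, 1)⟩
  have hpsd := posSemidef_plusRow hcn hcs hce hcw hns hne hnw hse hsw hew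
  rw [plusRow_eq hns hne hnw hse hsw hew] at hpsd
  have h0 := groundStateFunctional_nonneg_of_posSemidef (heisenbergTorus 2 L 1 1) hpsd
  have hω1 : (heisenbergTorus 2 L 1 1).groundStateFunctional 1 = 1 :=
    groundStateFunctional_one (heisenbergTorus_isHermitian 2 L 1 1)
  simp only [map_add, map_sub, map_smul, hω1, smul_eq_mul, mul_one] at h0
  obtain ⟨hre, -⟩ := Complex.nonneg_iff.mp h0
  simp only [Complex.add_re, Complex.sub_re, Complex.mul_re, Complex.re_ofNat, Complex.im_ofNat,
    zero_mul, sub_zero] at hre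
  rw [re_gsf_wpt L hns 0 2 (by decide) (by decide), re_gsf_wpt L hew 2 0 (by decide) (by decide),
    re_gsf_wpt L hne 1 1 (by decide) (by decide), re_gsf_wpt L hnw 1 1 (by decide) (by decide),
    re_gsf_wpt L hse 1 1 (by decide) (by decide), re_gsf_wpt L hsw 1 1 (by decide) (by decide),
    re_gsf_wpt L hcn 0 1 (by decide) (by decide), re_gsf_wpt L hcs 0 1 (by decide) (by decide),
    re_gsf_wpt L hce 1 0 (by decide) (by decide), re_gsf_wpt L hcw 1 0 (by decide) (by decide),
    heisRedCorr2_swap L 1 2 0, heisRedCorr2_swap L 1 1 0] at hre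
  linarith

/-- **Conversion row in the torus ground state**: `0 ≤ 5/12 + 4c(0,1) + c(0,2)` for every `L ≥ 3`. -/
theorem heis_ceilingRow_window (L : ℕ) [NeZero L] (hL : 3 ≤ L) :
    0 ≤ 5 / 12 + 4 * heisRedCorr2 L 1 0 1 + heisRedCorr2 L 1 0 2 := by
  have dist : ∀ p q : ℕ × ℕ, p.1 < L ∧ p.2 < L → q.1 < L ∧ q.2 < L → p ≠ q → wpt L p ≠ wpt L q :=
    fun p q hp hq hpq h => hpq (wpt_inj L hp hq h)
  have b0 : 0 < L := by omega
  have b1 : 1 < L := by omega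
  have b2 : 2 < L := by omega
  have hcn := dist (1, 1) (1, 2) ⟨b1, b1⟩ ⟨b1, b2⟩ (by decide)
  have hcs := dist (1, 1) (1, 0) ⟨b1, b1⟩ ⟨b1, b0⟩ (by decide)
  have hce := dist (1, 1) (2, 1) ⟨b1, b1⟩ ⟨b2, b1⟩ (by decide)
  have hcw := dist (1, 1) (0, 1) ⟨b1, b1⟩ ⟨b0, b1⟩ (by decide)
  have hns := dist (1, 2) (1, 0) ⟨b1, b2⟩ ⟨b1, b0⟩ (by decide)
  have hne := dist (1, 2) (2, 1) ⟨b1, b2⟩ ⟨b2, b1⟩ (by decide)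
  have hnw := dist (1, 2) (0, 1) ⟨b1, b2⟩ ⟨b0, b1⟩ (by decide)
  have hse := dist (1, 0) (2, 1) ⟨b1, b0⟩ ⟨b2, b1⟩ (by decide)
  have hsw := dist (1, 0) (0, 1) ⟨b1, b0⟩ ⟨b0, b1⟩ (by decide)
  have hew := dist (2, 1) (0, 1) ⟨b2, b1⟩ ⟨b0, b1⟩ (by decide)
  haveI : Nonempty (TorusSite 2 L) := ⟨wpt L (1, 1)⟩
  have hpsd := posSemidef_ceilingRow hcn hcs hce hcw hns hne hnw hse hsw hew
  have h0 := groundStateFunctional_nonneg_of_posSemidef (heisenbergTorus 2 L 1 1) hpsd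
  have hω1 : (heisenbergTorus 2 L 1 1).groundStateFunctional 1 = 1 :=
    groundStateFunctional_one (heisenbergTorus_isHermitian 2 L 1 1)
  simp only [map_add, map_smul, hω1, smul_eq_mul, mul_one] at h0
  obtain ⟨hre, -⟩ := Complex.nonneg_iff.mp h0
  simp only [Complex.add_re, Complex.mul_re, Complex.re_ofNat, Complex.im_ofNat,
    zero_mul, sub_zero] at hre
  rw [re_gsf_wpt L hns 0 2 (by decide) (by decide), re_gsf_wpt L hew 2 0 (by decide) (by decide),
    re_gsf_wpt L hcn 0 1 (by decide) (by decide), re_gsf_wpt L hcs 0 1 (by decide) (by decide),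
    re_gsf_wpt L hce 1 0 (by decide) (by decide), re_gsf_wpt L hcw 1 0 (by decide) (by decide),
    heisRedCorr2_swap L 1 2 0, heisRedCorr2_swap L 1 1 0] at hre
  linarith

/-- **Energy ceiling ⇒ `c(0,2)` floor.**  For an even torus `L = 2k ≥ 4`: if `E₀ ≤ q·L²` then
`c_L(0,2) ≥ -5/12 - 2q/3` (no infrared input; positive iff `q < -5/8`).  A hypothesis
`HeisTorusFamilyUpper P L₀ q` (mbboot E2 claim node) supplies `E₀ ≤ q·L²` on its residue class. -/
theorem heisRedCorr2_0_2_ge_of_groundEnergy_le (k : ℕ) (hk : 2 ≤ k) [NeZero (2 * k)] (q : ℝ)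
    (hE : (heisenbergTorus 2 (2 * k) 1 1).groundEnergy ≤ q * ((2 * k : ℕ) : ℝ) ^ 2) :
    -5 / 12 - 2 * q / 3 ≤ heisRedCorr2 (2 * k) 1 0 2 := by
  have hrow := heis_ceilingRow_window (2 * k) (by omega)
  have hε2 := heisBondCorr_two_eq (2 * k) 1
  have hεE := heisBondCorr_eq_groundEnergy_div (d := 2) (by norm_num) 1 k hk
  rw [heisRedCorr2_swap (2 * k) 1 1 0] at hε2
  have hLpos : (0 : ℝ) < ((2 * k : ℕ) : ℝ) ^ 2 := by
    have : (0 : ℝ) < ((2 * k : ℕ) : ℝ) := by exact_mod_cast (show 0 < 2 * k by omega)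
    positivity
  have e0 : heisRedCorr2 (2 * k) 1 0 1 =
      (heisenbergTorus 2 (2 * k) 1 1).groundEnergy / (6 * ((2 * k : ℕ) : ℝ) ^ 2) := by
    have h := hε2.symm.trans hεE
    have e6 : (3 * ((2 : ℕ) : ℝ) * ((2 * k : ℕ) : ℝ) ^ 2) = 6 * ((2 * k : ℕ) : ℝ) ^ 2 := by
      push_cast; ring
    rw [e6] at h
    linarith
  have hne0 : (6 * ((2 * k : ℕ) : ℝ) ^ 2) ≠ 0 := by positivity
  have h6 : heisRedCorr2 (2 * k) 1 0 1 * (6 * ((2 * k : ℕ) : ℝ) ^ 2) =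
      (heisenbergTorus 2 (2 * k) 1 1).groundEnergy := by
    rw [e0]; exact div_mul_cancel₀ _ hne0
  have hc01 : heisRedCorr2 (2 * k) 1 0 1 ≤ q / 6 := by
    rw [le_div_iff₀ (by norm_num : (0 : ℝ) < 6)]
    have h' : heisRedCorr2 (2 * k) 1 0 1 * 6 * ((2 * k : ℕ) : ℝ) ^ 2 ≤ q * ((2 * k : ℕ) : ℝ) ^ 2 := by
      rw [mul_assoc, h6]; exact hE
    exact le_of_mul_le_mul_right h' hLpos
  linarith

/-- The `8 ∣ L` instance: with the mbboot E2 claim node `heisTL_mps_upper_8x8_D48`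
(`E₀ ≤ (-705592546443/2⁴⁰)·L²` for `8 ∣ L ≥ 16`) as HYPOTHESIS in expanded form,
`c_L(0,2) ≥ 0.011155` — CONDITIONAL on that program-verified certificate claim. -/
theorem heisRedCorr2_0_2_ge_of_node8x8 (k : ℕ) (hk : 2 ≤ k) [NeZero (2 * k)]
    (hE : (heisenbergTorus 2 (2 * k) 1 1).groundEnergy ≤
      (-705592546443 / 1099511627776 : ℝ) * ((2 * k : ℕ) : ℝ) ^ 2) :
    (11155 : ℝ) / 10 ^ 6 ≤ heisRedCorr2 (2 * k) 1 0 2 := by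
  have h := heisRedCorr2_0_2_ge_of_groundEnergy_le k hk _ hE
  norm_num at h ⊢
  linarith

end Torus

end Summit.HubbardSuperconductivity.HubbardLadder.PlusAntipodal
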